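import Mathlib
import HarnessLib

/-!
# The Pfaffian of an alternating matrix, I: definition by Laplace-type expansion

The Pfaffian `pf A` of an alternating `2n × 2n` matrix `A = (a_{ij})` (`a_{ji} = -a_{ij}`,
`a_{ii} = 0`) over a commutative ring.  Following Kustin–Ulrich (Mem. AMS 461, §1, p. 9,
Def. 1.17 ff.: "For even sized matrices the pfaffian is defined by the Laplace expansion together
with the convention `pf [[0, x₁₂], [-x₁₂, 0]] = x₁₂`"; their (1.18) with `i = k = 1`) we DEFINE it
by the expansion along the first row,

  `pf A = Σ_{j = 2}^{2n} (-1)^j a_{1j} · pf (A with rows and columns 1, j deleted)`   (1-based),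

with `pf` of the empty matrix `= 1` and `pf` of any odd-sized matrix `= 0`; in this file's 0-based
indexing `pfaffian A = Σ_{j : Fin (n+1)} (-1)^j · A 0 j.succ · pfaffian (pfMinor A j)`, where
`pfMinor A j` deletes the indices `0` and `j.succ` (Anderson–Fulton, App. C.1, print the same
"Laplace-type expansion formula … useful for computing recursively", along the last column).  This
agrees with the classical sum over perfect matchings / the permutation formula
`(1/(2ⁿ n!)) Σ_{s ∈ S_{2n}} sgn(s) Π a_{s(2i-1) s(2i)}` (Goodman–Wallach, *Symmetry,
Representations, and Invariants*, App. B.2.6, (B.13)–(B.14) and the cofactor expansion (B.18);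
Anderson–Fulton C.1); e.g. `pfaffian_fin_four` is their `Pf₂(A) = a₁₂a₃₄ - a₁₃a₂₄ + a₁₄a₂₃`.
The definition only reads the entries `A i j` with `i < j` (`pfaffian_congr`), so no alternating
hypothesis is needed to state it.

## Main results (this file)

`pfaffian`, `pfMinor`, the unfolding lemma `pfaffian_fin_add_two`, small cases `pfaffian_fin_two`,
`pfaffian_fin_four`, `pfaffian_eq_zero_of_odd`, compatibility with ring maps `pfaffian_map` and
dependence on the strict upper triangle only `pfaffian_congr` (both expressing Goodman–Wallach's
"`Pf_k` is a homogeneous polynomial of degree `k` in the variables `a_{ij}`, `1 ≤ i < j ≤ 2k`").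

Sequels: `PfaffianRows.lean` (Laplace identity with alien cofactors, equal adjacent rows),
`PfaffianTransvection.lean` (multilinearity in a row–column pair, invariance under transvection
congruences, reduction of the first row), `PfaffianDeterminant.lean` (Cayley's theorem
`det A = (pf A)²`).

## References

* A. R. Kustin, B. Ulrich, *A family of complexes associated to an almost alternating map, with
  applications to residual intersections*, Mem. Amer. Math. Soc. **95** (1992) no. 461, §1 p. 9
  (Def. 1.17 ff.) and the Laplace expansion (1.18).  [KustinUlrich1992]
* R. Goodman, N. R. Wallach, *Symmetry, Representations, and Invariants*, GTM 255, Springer (2009),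
  Appendix B.2.6 (B.11)–(B.19), Lemma B.2.8, Corollary B.2.9.  [GoodmanWallachGTM255]
* D. Anderson, W. Fulton, *Equivariant Cohomology in Algebraic Geometry*, CUP (2023), Appendix C.1
  "Pfaffians" (entries in a commutative ring; Laplace-type expansion; multilinearity; `Pf(AᵀMA) =
  det A · Pf M`).  [AndersonFulton2023]
* A. Cayley, *Sur les déterminants gauches*, J. reine angew. Math. **38** (1849) 93–96. [Cayley1849]

## Mathlib

Mathlib (this pin) has `Matrix.det`, its Laplace expansions `Matrix.det_succ_row_zero` /
`det_succ_column_zero`, `Matrix.transvection`, but no Pfaffian (`rg -i pfaff Mathlib` is empty);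
the tree had only the explicit `4 × 4` / `6 × 6` Pfaffians of
`Literature/AlgebraicGeometry/Hassett2000/PfaffianSectionLoci.lean`,
`Matrix.pfaffianFour` of `Literature/Geometry/Riemannian/TwistorFrameChange.lean` and the
sign-pattern notion `IsPfaffianBipartite` of
`Literature/Combinatorics/SimpleGraph/PfaffianBipartite.lean`.
-/

namespace Literature.LinearAlgebra.Matrix

open Finset
open _root_.Matrix

variable {R : Type*} [CommRing R]

/-- `pfMinor A j`: the principal submatrix of the `(n+2) × (n+2)` matrix `A` obtained by deleting
the rows and columns `0` and `j.succ` (the increasing embedding `Fin n → Fin (n+2)` missing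
`{0, j+1}` is `Fin.succ ∘ j.succAbove`).  These are the sub-Pfaffian arguments in the Laplace-type
expansion of the Pfaffian along its first row. [cite: KustinUlrich1992, §1 (1.18)] -/
def pfMinor {n : ℕ} (A : Matrix (Fin (n + 2)) (Fin (n + 2)) R) (j : Fin (n + 1)) :
    Matrix (Fin n) (Fin n) R :=
  A.submatrix (Fin.succ ∘ j.succAbove) (Fin.succ ∘ j.succAbove)

/-- The **Pfaffian** of a square matrix over a commutative ring, defined by the Laplace-type
expansion along the first row: `pf (0 × 0) = 1`, `pf (1 × 1) = 0`, and for size `n + 2`,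
`pf A = Σ_j (-1)^j · A 0 (j+1) · pf (A without rows/columns 0, j+1)`; in 1-based notation
`pf A = Σ_{j ≥ 2} (-1)^j a_{1j} pf(A_{\hat 1 \hat j})` with `pf [[0, a], [-a, 0]] = a`.  Only the
entries above the diagonal are read.  For an alternating matrix this is the classical Pfaffian
(sum over perfect matchings), Goodman–Wallach (B.13)–(B.14), (B.18).
[cite: KustinUlrich1992, §1 p. 9 (Def. 1.17 ff.) and (1.18)] -/
def pfaffian : {n : ℕ} → Matrix (Fin n) (Fin n) R → R
  | 0, _ => 1
  | 1, _ => 0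
  | n + 2, A => ∑ j : Fin (n + 1), (-1) ^ (j : ℕ) * A 0 j.succ * pfaffian (pfMinor A j)

/-- `pf` of the empty matrix is `1`. [cite: KustinUlrich1992, §1 p. 9] -/
@[simp] theorem pfaffian_fin_zero (A : Matrix (Fin 0) (Fin 0) R) : pfaffian A = 1 := rfl

/-- `pf` of a `1 × 1` matrix is `0` (odd size). [cite: KustinUlrich1992, §1 p. 9] -/
@[simp] theorem pfaffian_fin_one (A : Matrix (Fin 1) (Fin 1) R) : pfaffian A = 0 := rfl

/-- The defining Laplace-type expansion along row `0`:
`pf A = Σ_j (-1)^j A 0 (j+1) · pf (pfMinor A j)`. [cite: KustinUlrich1992, §1 (1.18)] -/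
theorem pfaffian_fin_add_two {n : ℕ} (A : Matrix (Fin (n + 2)) (Fin (n + 2)) R) :
    pfaffian A = ∑ j : Fin (n + 1), (-1) ^ (j : ℕ) * A 0 j.succ * pfaffian (pfMinor A j) := rfl

omit [CommRing R] in
/-- Entries of `pfMinor A j` = "`A` with rows and columns `0` and `j+1` removed" (definitional
unfolding of the minors in the Laplace expansion). [cite: KustinUlrich1992, §1 (1.18)] -/
@[simp] theorem pfMinor_apply {n : ℕ} (A : Matrix (Fin (n + 2)) (Fin (n + 2)) R)
    (j : Fin (n + 1)) (a b : Fin n) :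
    pfMinor A j a b = A (j.succAbove a).succ (j.succAbove b).succ := rfl

/-- `pf [[·, a], [·, ·]] = a`: the Pfaffian of a `2 × 2` matrix is its `(0,1)` entry
(Kustin–Ulrich's normalisation `pf [[0, x₁₂], [-x₁₂, 0]] = x₁₂`; Goodman–Wallach `Pf₁(A) = a₁₂`).
[cite: KustinUlrich1992, §1 p. 9] -/
@[simp] theorem pfaffian_fin_two (A : Matrix (Fin 2) (Fin 2) R) : pfaffian A = A 0 1 := by
  rw [pfaffian_fin_add_two, Fin.sum_univ_one]
  simp

/-- The `4 × 4` Pfaffian `a₀₁a₂₃ - a₀₂a₁₃ + a₀₃a₁₂` (Goodman–Wallach's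
`Pf₂(A) = a₁₂a₃₄ - a₁₃a₂₄ + a₁₄a₂₃` in 1-based indices).
[cite: GoodmanWallachGTM255, App. B.2.6 after (B.17)] -/
theorem pfaffian_fin_four (A : Matrix (Fin 4) (Fin 4) R) :
    pfaffian A = A 0 1 * A 2 3 - A 0 2 * A 1 3 + A 0 3 * A 1 2 := by
  rw [pfaffian_fin_add_two, Fin.sum_univ_three]
  simp only [pfaffian_fin_two, pfMinor_apply]
  simp [Fin.succAbove, Fin.lt_def]
  ring

/-- The Pfaffian of an odd-sized matrix vanishes (by definition: the recursion bottoms out at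
`1 × 1`). [cite: KustinUlrich1992, §1 p. 9] -/
theorem pfaffian_eq_zero_of_odd : ∀ {n : ℕ} (A : Matrix (Fin n) (Fin n) R),
    Odd n → pfaffian A = 0
  | 0, _, h => by simp at h
  | 1, _, _ => rfl
  | n + 2, A, h => by
      rw [pfaffian_fin_add_two]
      refine Finset.sum_eq_zero fun j _ => ?_
      have hn : Odd n := by
        rcases h with ⟨k, hk⟩
        exact ⟨k - 1, by omega⟩
      rw [pfaffian_eq_zero_of_odd (pfMinor A j) hn, mul_zero]

/-- The Pfaffian commutes with ring homomorphisms — it is a polynomial with integer coefficients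
in the entries (Goodman–Wallach: "`Pf_k` is a homogeneous polynomial of degree `k` in the variables
`a_{ij}`"; Anderson–Fulton C.1: entries in any commutative ring).
[cite: GoodmanWallachGTM255, App. B.2.6 after (B.17)] -/
theorem pfaffian_map {S : Type*} [CommRing S] (f : R →+* S) :
    ∀ {n : ℕ} (A : Matrix (Fin n) (Fin n) R), pfaffian (A.map f) = f (pfaffian A)
  | 0, _ => by simp
  | 1, _ => by simp
  | n + 2, A => by
      rw [pfaffian_fin_add_two, pfaffian_fin_add_two, map_sum]
      refine Finset.sum_congr rfl fun j _ => ?_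
      rw [map_mul, map_mul, map_pow, map_neg, map_one, ← pfaffian_map f (pfMinor A j)]
      rfl

/-- The Pfaffian only reads the entries strictly above the diagonal: two matrices that agree
there have the same Pfaffian (Goodman–Wallach: a polynomial "in the variables `a_{ij}`, for
`1 ≤ i < j ≤ 2k`"). [cite: GoodmanWallachGTM255, App. B.2.6 after (B.17)] -/
theorem pfaffian_congr : ∀ {n : ℕ} {A B : Matrix (Fin n) (Fin n) R},
    (∀ i j, i < j → A i j = B i j) → pfaffian A = pfaffian B
  | 0, _, _, _ => rfl
  | 1, _, _, _ => rfl
  | n + 2, A, B, h => by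
      rw [pfaffian_fin_add_two, pfaffian_fin_add_two]
      refine Finset.sum_congr rfl fun j _ => ?_
      rw [h 0 j.succ (Fin.succ_pos j),
        pfaffian_congr (A := pfMinor A j) (B := pfMinor B j) fun a b hab => ?_]
      simp only [pfMinor_apply]
      exact h _ _ (Fin.succ_lt_succ_iff.mpr (Fin.strictMono_succAbove j hab))

end Literature.LinearAlgebra.Matrix
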